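import Mathlib

/-!
# SecondOrderEnergyConcave — the two elementary facts behind DEQ-A208 §3 (F1)

Receipt for the pub-qadeq-deq-2 note DEQ-A208 (Guo–Buda–Wiebe, arXiv:2511.17821v1).
The paper models a nuclear displacement by a LINEAR coupling `H(s) = H₀ + s V` and calls
`k = ∂²ₛ E₀(s)|₀ = Σ_{k ≠ 0} |⟨E_k|V|E₀⟩|² / (E₀ − E_k)` a spring constant.  Two textbook facts
say this number is never positive:

* `sumOverStates_nonpos` — if every excited level lies above `E₀` and the weights are
  non-negative, the sum-over-states expression is `≤ 0` (second-order perturbation theory lowers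
  the ground state; Griffiths–Schroeter, *Introduction to Quantum Mechanics*, Problem 7.5(b));
* `groundEnergy_concaveOn` — the variational form: a function that lies below a family of affine
  functions `s ↦ a ψ + s * b ψ` (the trial energies `⟨ψ|H₀ + sV|ψ⟩`) and touches one of them at
  every point (the ground state of `H₀ + sV`) is concave on `ℝ`.

Pure real analysis over Mathlib; no physics and no complexity statement is formalised here.
HONEST FRAMING: instance-level adjudication of specific advantage claims; no claim about
BQP vs BPP or the summit.
-/

namespace Summit.QuantumAdvantage.Dequantization.SecondOrderEnergyConcave

open Finset

/-- **Sign of the sum over states.**  For a finite set of excited levels `E k > E0` and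
non-negative weights `w k` (in the application `w k = |⟨E_k|V|E₀⟩|²`),
`∑ w k / (E0 - E k) ≤ 0`. -/
theorem sumOverStates_nonpos {ι : Type*} (S : Finset ι) (w E : ι → ℝ) (E0 : ℝ)
    (hw : ∀ k ∈ S, 0 ≤ w k) (hE : ∀ k ∈ S, E0 < E k) :
    ∑ k ∈ S, w k / (E0 - E k) ≤ 0 := by
  apply Finset.sum_nonpos
  intro k hk
  have h1 : 0 ≤ w k := hw k hk
  have h2 : E0 - E k ≤ 0 := by linarith [hE k hk]
  exact div_nonpos_iff.mpr (Or.inl ⟨h1, h2⟩)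

/-- The paper's second-order energy shift `2 · ∑ w k / (E0 - E k)` is non-positive as well. -/
theorem secondOrderShift_nonpos {ι : Type*} (S : Finset ι) (w E : ι → ℝ) (E0 : ℝ)
    (hw : ∀ k ∈ S, 0 ≤ w k) (hE : ∀ k ∈ S, E0 < E k) :
    2 * ∑ k ∈ S, w k / (E0 - E k) ≤ 0 := by
  have := sumOverStates_nonpos S w E E0 hw hE
  linarith

/-- **Strict version.**  If in addition some level carries positive weight, the sum is `< 0`
(a non-trivial coupling strictly lowers the ground energy at second order). -/
theorem sumOverStates_neg {ι : Type*} (S : Finset ι) (w E : ι → ℝ) (E0 : ℝ)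
    (hw : ∀ k ∈ S, 0 ≤ w k) (hE : ∀ k ∈ S, E0 < E k) {k₀ : ι} (hk₀ : k₀ ∈ S)
    (hpos : 0 < w k₀) :
    ∑ k ∈ S, w k / (E0 - E k) < 0 := by
  classical
  have hterm : ∀ k ∈ S, w k / (E0 - E k) ≤ 0 := by
    intro k hk
    have h1 : 0 ≤ w k := hw k hk
    have h2 : E0 - E k ≤ 0 := by linarith [hE k hk]
    exact div_nonpos_iff.mpr (Or.inl ⟨h1, h2⟩)
  have hk₀neg : w k₀ / (E0 - E k₀) < 0 :=
    div_neg_of_pos_of_neg hpos (by linarith [hE k₀ hk₀])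
  calc ∑ k ∈ S, w k / (E0 - E k)
      = w k₀ / (E0 - E k₀) + ∑ k ∈ S.erase k₀, w k / (E0 - E k) := by
        rw [← Finset.add_sum_erase S _ hk₀]
    _ < 0 + 0 := by
        apply add_lt_add_of_lt_of_le hk₀neg
        exact Finset.sum_nonpos fun k hk => hterm k (Finset.mem_of_mem_erase hk)
    _ = 0 := by ring

/-- **Variational concavity of the ground energy in a linear coupling.**  If `E s ≤ a ψ + s * b ψ`
for every trial label `ψ` and every `s`, and at every `s` equality is attained by some `ψ`, then
`E` is concave on all of `ℝ`.  (With `a ψ = ⟨ψ|H₀|ψ⟩`, `b ψ = ⟨ψ|V|ψ⟩` over unit vectors this is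
`E₀(s) = min_ψ ⟨ψ|H₀ + sV|ψ⟩`.) -/
theorem groundEnergy_concaveOn {Ψ : Type*} (a b : Ψ → ℝ) (E : ℝ → ℝ)
    (hle : ∀ ψ s, E s ≤ a ψ + s * b ψ) (hatt : ∀ s, ∃ ψ, E s = a ψ + s * b ψ) :
    ConcaveOn ℝ Set.univ E := by
  refine ⟨convex_univ, ?_⟩
  intro x _ y _ t u ht hu htu
  obtain ⟨ψ, hψ⟩ := hatt (t • x + u • y)
  have hx := hle ψ x
  have hy := hle ψ y
  simp only [smul_eq_mul] at hψ ⊢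
  have h1 : t * E x ≤ t * (a ψ + x * b ψ) := mul_le_mul_of_nonneg_left hx ht
  have h2 : u * E y ≤ u * (a ψ + y * b ψ) := mul_le_mul_of_nonneg_left hy hu
  have hu' : u = 1 - t := by linarith
  have h3 : t * (a ψ + x * b ψ) + u * (a ψ + y * b ψ) = a ψ + (t * x + u * y) * b ψ := by
    rw [hu']; ring
  linarith [h1, h2, h3, hψ]

/-- Concave functions have non-positive second differences: for the ground energy this is the
statement that the symmetric difference quotient `E(s+h) - 2 E(s) + E(s-h)` — whose limit is the
paper's `∂²ₛ E₀` — is `≤ 0`. -/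
theorem secondDifference_nonpos {E : ℝ → ℝ} (hE : ConcaveOn ℝ Set.univ E) (s h : ℝ) :
    E (s + h) - 2 * E s + E (s - h) ≤ 0 := by
  have key := hE.2 (Set.mem_univ (s + h)) (Set.mem_univ (s - h))
    (show (0 : ℝ) ≤ 1 / 2 by norm_num) (show (0 : ℝ) ≤ 1 / 2 by norm_num) (by norm_num)
  simp only [smul_eq_mul] at key
  have hmid : (1 / 2 : ℝ) * (s + h) + 1 / 2 * (s - h) = s := by ring
  rw [hmid] at key
  linarith

end Summit.QuantumAdvantage.Dequantization.SecondOrderEnergyConcave
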